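import Literature.NumberTheory.Automorphic.AutomorphicTwistNorm
import Literature.NumberTheory.Automorphic.SatakeParamNeZeroProofs
import HarnessLib

/-!
# `log |det|_𝔸` is an automorphic form on `GL_n(𝔸_K)`; the cuspidal datum `span {log ‖·‖_𝔸, 1} / ℂ·1`
# on `GL_1` has no stable complement — refutation of the named fact `cuspidal_W'_eq_bot`

Topic `NumberTheory/Automorphic`; proofs file (theorems only: no definition, no named fact), in the
vocabulary of `AutomorphicForms` (`IsAutomorphicForm`, `IsStableSubmodule`, `AutomorphicRepData`),
`AutomorphicRepsGL` (`CuspidalAutomorphicRepData`, `cuspFormsGL`, `cuspidal_W'_eq_bot`),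
`ArchimedeanCalculus` (`IsArchSmooth`, `lieDeriv`, `IsZFinite`, `IsKFinite`) and `IdeleNormDetGL`.

## Main results

* `isAutomorphicForm_affLogDet` — **for `n ≥ 1` and `a, b ∈ ℂ`, `ψ = a · log |det|_𝔸 + b` is an
  automorphic form on `GL_n(𝔸_K)`** in the sense of Borel–Jacquet 1979, 4.2: left `GL_n(K)`-invariant
  (product formula), right invariant under every level (`|det|_𝔸 = 1` on compact subgroups of
  `GL_n(𝔸_K^∞)`), smooth with Lie derivatives `X ψ = a λ(X)` constant (`|det (exp X, 1)|_𝔸 = e^{λ(X)}`,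
  `lieDeriv_affLogDet`), `K_∞`- and `Z(𝔤)`-finite (its whole `U(𝔤)`-orbit and all its `K_∞`-translates
  lie in `span {ψ, 1}`), of moderate growth (`|log |det g|_𝔸| ≤ |det g|_𝔸 + |det g|_𝔸⁻¹ ≤
  2 (n!)^{[K:ℚ]} (1 ⊔ ‖g‖)^{n[K:ℚ]}`).
* `isStableSubmodule_span_logDet`, `isStableSubmodule_span_one`, `span_one_lt_span_logDet`,
  `eq_or_eq_of_span_one_le_of_le_span_logDet` — `W = span {log |det|_𝔸, 1} ⊋ W' = ℂ · 1` are
  `(𝔤, K_∞) × GL_n(𝔸_K^∞)`-stable spaces of automorphic forms with `W / W'` a line, on which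
  `GL_n(𝔸_K)` acts unipotently: `r(h) ψ = ψ + a log |det h|_𝔸 · 1` (`rightTranslation_smul_logDet_add`).
* `exists_cuspidalAutomorphicRepData_gl_one_span_logDet` — on `GL_1` (no proper parabolic, so every
  automorphic form is a cusp form) `π_log = W / W'` is a `CuspidalAutomorphicRepData 1 K hcpt`.
* `not_exists_cuspidal_complement_span_logDet`, **`not_cuspidal_W'_eq_bot_gl_one`**,
  `not_cuspidal_W'_eq_bot_gl_one'`, `not_forall_cuspidal_W'_eq_bot` — **the named fact
  `cuspidal_W'_eq_bot hcpt` of `AutomorphicRepsGL` ("a cuspidal `W / W'` is realised on a stable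
  complement `W₀` of `W'`") is false for `n = 1` over every number field**: a stable `W₀` with
  `W₀ ⊓ ℂ·1 = ⊥`, `W₀ ⊔ ℂ·1 = W` contains some `ψ = c log ‖·‖_𝔸 + d` with `c ≠ 0`, and for the finite
  idele `t_v` (`‖t_v‖_𝔸 = q_v⁻¹`) `r(t_v) ψ - ψ = c log q_v⁻¹ · 1 ∈ W₀ ⊓ ℂ·1 = ⊥`. In particular the
  family hypothesis `∀ n K hcpt, cuspidal_W'_eq_bot hcpt` consumed by
  `ArthurClozel_fibres_quadratic_of_leaves` (`ArthurClozelFibresRepData`) and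
  `JacquetShalika_eq_of_rsData_eq_of_leaves` (`LanglandsTetrahedralProofs`) is `False`
  (`not_forall_cuspidal_W'_eq_bot`); the reductions that survive are the ones through the weaker,
  true statement "some clean cuspidal datum has the same Satake parameters"
  (`JacquetShalika_eq_of_rsData_eq_of_L2`).

## Why the fact fails, and what is true

Borel–Jacquet 1979, 4.2 and 4.6 (which `AutomorphicForms` / `AutomorphicRepsGL` transcribe) impose
no condition at the split component `A_G`: the general automorphic form is
`∑ P_i(H_G(g)) e^{⟨λ_i, H_G(g)⟩} φ_i(g)` with `φ_i` `A_G`-invariant and `P_i` polynomials on `𝔞_G`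
(Mœglin–Waldspurger 1994, I.2.17–I.2.18; here `P(H) = H`, `λ = 0`, `φ = 1` on `GL_1`), and on such
spaces `G(𝔸)` acts unipotently, not semisimply. Semisimplicity of cusp forms
(Gelfand–Piatetski-Shapiro; Borel–Jacquet 1979, 4.6 (3) ⇒ (1)) holds for the space of cusp forms
*with a fixed central character* (equivalently, on which `A_G` acts by a character), which embeds in
the unitary `L²_cusp`. For `n ≥ 2` the same construction `log |det|_𝔸 · V₀ ⊕ V₀` over any clean
cuspidal datum `V₀` gives non-split data, so `cuspidal_W'_eq_bot hcpt` can only hold vacuously; the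
`GL_1` case proved here needs no existence theorem for cusp forms.

## References

* A. Borel, H. Jacquet, *Automorphic forms and automorphic representations*, Proc. Sympos. Pure
  Math. 33 (Corvallis 1979), part 1, §4.2–4.6, 5.7 [BorelJacquet1979].
* C. Mœglin, J.-L. Waldspurger, *Décomposition spectrale et séries d'Eisenstein*, Progress in
  Math. 113 (1994), I.2.17–I.2.18, I.3.2–I.3.4.
-/

noncomputable section

open scoped MatrixGroups NNReal Classical ContDiff
open NumberField IsDedekindDomain

namespace Literature.NumberTheory.Automorphic

open Literature.NumberTheory.GaloisRepresentations (ideleGroup)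

variable {n : ℕ} {K : Type} [Field K] [NumberField K]

/-! ### `log |det g|_𝔸`: additive, trivial on `GL_n(K)` and on levels, linear along `exp 𝔤` -/

/-- `|det g|_𝔸 > 0`. [folklore] -/
theorem ideleNorm_det_pos (g : GL (Fin n) (AdeleRing (𝓞 K) K)) :
    0 < GaloisRepresentations.ideleNorm (Matrix.GeneralLinearGroup.det g) := by
  rw [← coe_ideleNorm]
  exact NNReal.coe_pos.2 (pos_iff_ne_zero.2 (ideleNorm_ne_zero _))

/-- `log |det (g h)|_𝔸 = log |det g|_𝔸 + log |det h|_𝔸` (group elements typed on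
`(AdelicGroupData.gl n K).Adelic`, typing rule of `AutomorphicRepsGL`). [folklore] -/
theorem log_ideleNorm_det_mul (g h : (AdelicGroupData.gl n K).Adelic) :
    Real.log (GaloisRepresentations.ideleNorm (Matrix.GeneralLinearGroup.det (g * h))) =
      Real.log (GaloisRepresentations.ideleNorm (Matrix.GeneralLinearGroup.det g)) +
        Real.log (GaloisRepresentations.ideleNorm (Matrix.GeneralLinearGroup.det h)) := by
  have hdet : Matrix.GeneralLinearGroup.det (g * h) =
      Matrix.GeneralLinearGroup.det g * Matrix.GeneralLinearGroup.det h :=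
    map_mul Matrix.GeneralLinearGroup.det (show GL (Fin n) (AdeleRing (𝓞 K) K) from g) h
  rw [hdet, ← coe_ideleNorm, map_mul, NNReal.coe_mul, coe_ideleNorm, coe_ideleNorm,
    Real.log_mul (ideleNorm_det_pos g).ne' (ideleNorm_det_pos h).ne']

/-- `log |det 1|_𝔸 = 0`. [folklore] -/
theorem log_ideleNorm_det_one :
    Real.log (GaloisRepresentations.ideleNorm
      (Matrix.GeneralLinearGroup.det (1 : (AdelicGroupData.gl n K).Adelic))) = 0 := by
  have h1 : Matrix.GeneralLinearGroup.det (1 : (AdelicGroupData.gl n K).Adelic) = 1 :=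
    map_one (Matrix.GeneralLinearGroup.det : GL (Fin n) (AdeleRing (𝓞 K) K) →* _)
  rw [h1, ← coe_ideleNorm, map_one, NNReal.coe_one, Real.log_one]

/-- `log |det γ|_𝔸 = 0` for `γ ∈ GL_n(K)` (product formula). [folklore] -/
theorem log_ideleNorm_det_eq_zero_of_mem_arithmeticSubgroup {γ : (AdelicGroupData.gl n K).Adelic}
    (hγ : γ ∈ (AdelicGroupData.gl n K).arithmeticSubgroup) :
    Real.log (GaloisRepresentations.ideleNorm (Matrix.GeneralLinearGroup.det γ)) = 0 := by
  obtain ⟨γ₀, rfl⟩ := hγ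
  rw [GaloisRepresentations.ideleNorm_eq_one_of_mem_principalIdeles
    (GLn.det_toAdelic_mem_principalIdeles n γ₀), Real.log_one]

/-- `log |det u|_𝔸 = 0` on every level `U ∈ finiteLevelsGL n K` (`|det|_𝔸 = 1` on compact subgroups
of `GL_n(𝔸_K^∞)`). [folklore] -/
theorem log_ideleNorm_det_eq_zero_of_mem_finiteLevelsGL
    {U : Subgroup (AdelicGroupData.gl n K).Adelic} (hU : U ∈ finiteLevelsGL n K)
    {u : (AdelicGroupData.gl n K).Adelic} (hu : u ∈ U) :
    Real.log (GaloisRepresentations.ideleNorm (Matrix.GeneralLinearGroup.det u)) = 0 := by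
  obtain ⟨U₀, -, hU₀c, rfl⟩ := hU
  obtain ⟨u₀, hu₀, rfl⟩ := hu
  rw [← coe_ideleNorm, ideleNorm_det_ofFinite_eq_one_of_isCompact n K hU₀c hu₀, NNReal.coe_one,
    Real.log_one]

/-- **`log |det (exp X, 1)|_𝔸 = λ(X)`** along the one-parameter subgroups of `𝔤 = 𝔤𝔩_n(K_∞)`, for a
real linear form `λ` on `𝔤` (`|det (exp X, 1)|_𝔸 = e^{λ(X)}`,
`exists_linearMap_ideleNorm_det_ofInfinite_expGL`). [folklore] -/
theorem exists_linearMap_log_ideleNorm_det_ofArch_expMem (hcpt : isCompact_glFiniteIntegralLevel n K) :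
    ∃ lam : (AutomorphyDatum.gl n K hcpt).arch.lie →ₗ[ℝ] ℝ,
      ∀ X : (AutomorphyDatum.gl n K hcpt).arch.lie,
        Real.log (GaloisRepresentations.ideleNorm (Matrix.GeneralLinearGroup.det
          ((AutomorphyDatum.gl n K hcpt).ofArch ((AutomorphyDatum.gl n K hcpt).arch.expMem X)))) =
          lam X := by
  -- Mathlib idiom (Mathlib/Algebra/Lie/OfAssociative.lean): the commutator Lie ring on matrices
  letI : LieRing (Matrix (Fin n) (Fin n) (mixedEmbedding.mixedSpace K)) := LieRing.ofAssociativeRing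
  obtain ⟨lam₀, -, hlam₀⟩ := exists_linearMap_ideleNorm_det_ofInfinite_expGL n K
  refine ⟨lam₀.comp (AutomorphyDatum.gl n K hcpt).arch.lie.toSubmodule.subtype, fun X => ?_⟩
  rw [AutomorphyDatum.gl_ofArch_apply, RealMatrixGroup.coe_expMem, hlam₀, Real.log_exp]
  rfl

/-- A finite place of `K` and a uniformizer of `K_v` (from a uniformizer in `K`). [folklore] -/
theorem exists_heightOneSpectrum_uniformizer (K : Type) [Field K] [NumberField K] :
    ∃ (v : HeightOneSpectrum (𝓞 K)) (ϖ : (v.adicCompletion K)ˣ),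
      Valued.v (ϖ : v.adicCompletion K) = WithZero.exp (-1 : ℤ) := by
  obtain ⟨𝔪, h𝔪⟩ := Ideal.exists_maximal (𝓞 K)
  let v : HeightOneSpectrum (𝓞 K) :=
    ⟨𝔪, h𝔪.isPrime, Ring.ne_bot_of_isMaximal_of_not_isField h𝔪 (RingOfIntegers.not_isField K)⟩
  obtain ⟨π, hπ⟩ := HeightOneSpectrum.valuation_exists_uniformizer K v
  have hval' : Valued.v (algebraMap K (v.adicCompletion K) π) = v.valuation K π :=
    HeightOneSpectrum.valuedAdicCompletion_eq_valuation' v π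
  have hval : Valued.v (algebraMap K (v.adicCompletion K) π) = WithZero.exp (-1 : ℤ) := by
    rw [hval', hπ]
  have hne : algebraMap K (v.adicCompletion K) π ≠ 0 := fun h => by
    rw [h, map_zero] at hval
    exact WithZero.coe_ne_zero hval.symm
  exact ⟨v, Units.mk0 _ hne, hval⟩

/-- **A finite idele moving `log |det|_𝔸`**: for `n ≥ 1` there is `h ∈ GL_n(𝔸_K^∞)` with
`log |det h|_𝔸 ≠ 0` (the Hecke matrix `t_{v,1}`, `|det t_{v,1}|_𝔸 = q_v⁻¹`). [folklore] -/
theorem exists_finiteAdelic_log_ideleNorm_det_ne_zero [NeZero n]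
    (hcpt : isCompact_glFiniteIntegralLevel n K) :
    ∃ h ∈ (AutomorphyDatum.gl n K hcpt).finiteAdelic,
      Real.log (GaloisRepresentations.ideleNorm (Matrix.GeneralLinearGroup.det h)) ≠ 0 := by
  obtain ⟨v, ϖ, hϖ⟩ := exists_heightOneSpectrum_uniformizer K
  refine ⟨heckeDiagAt n K v ϖ 1, ?_, ?_⟩
  · rw [AutomorphyDatum.gl_finiteAdelic]
    exact heckeDiagAt_mem_range_ofFinite n K v ϖ 1
  · have hq : (1 : ℝ) < v.residueCard := by exact_mod_cast v.one_lt_residueCard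
    rw [ideleNorm_det_heckeDiagAt hϖ (NeZero.one_le), pow_one]
    exact Real.log_ne_zero_of_pos_of_ne_one (inv_pos.2 (zero_lt_one.trans hq))
      (inv_lt_one_of_one_lt₀ hq).ne

/-! ### The functions `ψ = a · log |det|_𝔸 + b` are automorphic forms on `GL_n(𝔸_K)` -/

section Affine

variable {hcpt : isCompact_glFiniteIntegralLevel n K} {a b : ℂ}
  {ψ : (AdelicGroupData.gl n K).Adelic → ℂ}

/-- `ψ (g h) = ψ g + a log |det h|_𝔸` for `ψ = a log |det|_𝔸 + b`. [folklore] -/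
theorem affLogDet_apply_mul
    (hψ : ∀ g, ψ g = a * Real.log (GaloisRepresentations.ideleNorm (Matrix.GeneralLinearGroup.det g)) + b)
    (g h : (AdelicGroupData.gl n K).Adelic) :
    ψ (g * h) = ψ g + a * Real.log (GaloisRepresentations.ideleNorm (Matrix.GeneralLinearGroup.det h)) := by
  rw [hψ, hψ g, log_ideleNorm_det_mul, Complex.ofReal_add]
  ring

/-- `c ψ + d = (c a) log |det|_𝔸 + (c b + d)`: the span of `ψ` and `1` consists of functions of the
same shape. [folklore] -/
theorem affLogDet_smul_add
    (hψ : ∀ g, ψ g = a * Real.log (GaloisRepresentations.ideleNorm (Matrix.GeneralLinearGroup.det g)) + b)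
    (c d : ℂ) (g : (AdelicGroupData.gl n K).Adelic) :
    (c • ψ + d • (1 : (AdelicGroupData.gl n K).Adelic → ℂ)) g =
      c * a * Real.log (GaloisRepresentations.ideleNorm (Matrix.GeneralLinearGroup.det g)) + (c * b + d) := by
  rw [Pi.add_apply, Pi.smul_apply, Pi.smul_apply, Pi.one_apply, smul_eq_mul, smul_eq_mul, mul_one, hψ]
  ring

/-- `ψ = a log |det|_𝔸 + b` is left `GL_n(K)`-invariant (product formula).
Borel–Jacquet 1979, §4.2 (a). [cite: BorelJacquet1979, §4.2] -/
theorem isLeftInvariant_affLogDet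
    (hψ : ∀ g, ψ g = a * Real.log (GaloisRepresentations.ideleNorm (Matrix.GeneralLinearGroup.det g)) + b) :
    IsLeftInvariant (AdelicGroupData.gl n K) ψ := by
  intro γ hγ g
  rw [hψ, hψ g, log_ideleNorm_det_mul, log_ideleNorm_det_eq_zero_of_mem_arithmeticSubgroup hγ, zero_add]

/-- `ψ = a log |det|_𝔸 + b` is right invariant under every level. Borel–Jacquet 1979, §4.2 (a). [cite: BorelJacquet1979, §4.2] -/
theorem isRightInvariantUnder_affLogDet
    (hψ : ∀ g, ψ g = a * Real.log (GaloisRepresentations.ideleNorm (Matrix.GeneralLinearGroup.det g)) + b)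
    {U : Subgroup (AdelicGroupData.gl n K).Adelic} (hU : U ∈ finiteLevelsGL n K) :
    IsRightInvariantUnder U ψ := by
  intro u hu g
  rw [affLogDet_apply_mul hψ, log_ideleNorm_det_eq_zero_of_mem_finiteLevelsGL hU hu,
    Complex.ofReal_zero, mul_zero, add_zero]

/-- Along the flow of `X ∈ 𝔤`: `ψ (g · (exp X, 1)) = ψ g + a λ(X)`. [folklore] -/
theorem affLogDet_apply_mul_ofArch_expMem
    (hψ : ∀ g, ψ g = a * Real.log (GaloisRepresentations.ideleNorm (Matrix.GeneralLinearGroup.det g)) + b)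
    {lam : (AutomorphyDatum.gl n K hcpt).arch.lie →ₗ[ℝ] ℝ}
    (hlam : ∀ X : (AutomorphyDatum.gl n K hcpt).arch.lie,
      Real.log (GaloisRepresentations.ideleNorm (Matrix.GeneralLinearGroup.det
        ((AutomorphyDatum.gl n K hcpt).ofArch ((AutomorphyDatum.gl n K hcpt).arch.expMem X)))) = lam X)
    (g : (AdelicGroupData.gl n K).Adelic) (X : (AutomorphyDatum.gl n K hcpt).arch.lie) :
    ψ (g * (AutomorphyDatum.gl n K hcpt).ofArch ((AutomorphyDatum.gl n K hcpt).arch.expMem X)) =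
      ψ g + a * (lam X : ℂ) := by
  rw [affLogDet_apply_mul hψ, hlam]

open scoped Matrix.Norms.Operator in
/-- `ψ = a log |det|_𝔸 + b` is smooth in the archimedean variable (`X ↦ ψ (g (exp X, 1)) = ψ g + a λ(X)`
is affine). Borel–Jacquet 1979, §4.2 (b). [cite: BorelJacquet1979, §4.2] -/
theorem isArchSmooth_affLogDet
    (hψ : ∀ g, ψ g = a * Real.log (GaloisRepresentations.ideleNorm (Matrix.GeneralLinearGroup.det g)) + b) :
    IsArchSmooth (AutomorphyDatum.gl n K hcpt).ofArch ψ := by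
  haveI : FiniteDimensional ℝ (mixedEmbedding.mixedSpace K) := inferInstance
  -- Mathlib idiom (Mathlib/Algebra/Lie/OfAssociative.lean): the commutator Lie ring on matrices
  letI : LieRing (Matrix (Fin n) (Fin n) (mixedEmbedding.mixedSpace K)) := LieRing.ofAssociativeRing
  obtain ⟨lam, hlam⟩ := exists_linearMap_log_ideleNorm_det_ofArch_expMem hcpt
  intro g
  let lam' : (AutomorphyDatum.gl n K hcpt).arch.lie.toSubmodule →ₗ[ℝ] ℝ :=
    { toFun := fun X => lam ⟨X, X.2⟩
      map_add' := fun X Y => by rw [← map_add]; rfl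
      map_smul' := fun r X => by rw [RingHom.id_apply, ← map_smul]; rfl }
  have hlin : ContDiff ℝ ∞ fun X : (AutomorphyDatum.gl n K hcpt).arch.lie.toSubmodule =>
      ((lam ⟨X, X.2⟩ : ℝ) : ℂ) :=
    Complex.ofRealCLM.contDiff.comp (LinearMap.toContinuousLinearMap lam').contDiff
  have hfun : (fun X : (AutomorphyDatum.gl n K hcpt).arch.lie.toSubmodule ↦
      ψ (g * (AutomorphyDatum.gl n K hcpt).ofArch ((AutomorphyDatum.gl n K hcpt).arch.expMem ⟨X, X.2⟩))) =
      fun X : (AutomorphyDatum.gl n K hcpt).arch.lie.toSubmodule => ψ g + a * ((lam ⟨X, X.2⟩ : ℝ) : ℂ) := by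
    funext X
    exact affLogDet_apply_mul_ofArch_expMem hψ hlam g _
  rw [hfun]
  exact contDiff_const.add (contDiff_const.mul hlin)

/-- **The Lie derivative of `ψ = a log |det|_𝔸 + b` is the constant `a λ(X)`.**
Borel–Jacquet 1979, §1.5. [cite: BorelJacquet1979, §1.5] -/
theorem lieDeriv_affLogDet
    (hψ : ∀ g, ψ g = a * Real.log (GaloisRepresentations.ideleNorm (Matrix.GeneralLinearGroup.det g)) + b)
    {lam : (AutomorphyDatum.gl n K hcpt).arch.lie →ₗ[ℝ] ℝ}
    (hlam : ∀ X : (AutomorphyDatum.gl n K hcpt).arch.lie,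
      Real.log (GaloisRepresentations.ideleNorm (Matrix.GeneralLinearGroup.det
        ((AutomorphyDatum.gl n K hcpt).ofArch ((AutomorphyDatum.gl n K hcpt).arch.expMem X)))) = lam X)
    (X : (AutomorphyDatum.gl n K hcpt).arch.lie) :
    lieDeriv (AutomorphyDatum.gl n K hcpt).ofArch X ψ = fun _ => a * (lam X : ℂ) := by
  funext g
  have hfun : (fun t : ℝ => ψ (g * (AutomorphyDatum.gl n K hcpt).ofArch
      ((AutomorphyDatum.gl n K hcpt).arch.expMem (t • X)))) =
      fun t : ℝ => ψ g + a * ((t : ℂ) * (lam X : ℂ)) := by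
    funext t
    rw [affLogDet_apply_mul_ofArch_expMem hψ hlam, map_smul, smul_eq_mul, Complex.ofReal_mul]
  have h1 : HasDerivAt (fun t : ℝ => (t : ℂ) * (lam X : ℂ)) (lam X : ℂ) 0 := by
    simpa using (Complex.ofRealCLM.hasDerivAt (x := (0 : ℝ))).mul_const (lam X : ℂ)
  have hd : HasDerivAt (fun t : ℝ => ψ g + a * ((t : ℂ) * (lam X : ℂ))) (a * (lam X : ℂ)) 0 :=
    (h1.const_mul a).const_add (ψ g)
  unfold lieDeriv
  rw [hfun, hd.deriv]

/-- The Lie derivatives preserve `span {ψ, 1}` (they map it to constants).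
Borel–Jacquet 1979, §1.5. [cite: BorelJacquet1979, §1.5] -/
theorem lieDeriv_mem_span_affLogDet
    (hψ : ∀ g, ψ g = a * Real.log (GaloisRepresentations.ideleNorm (Matrix.GeneralLinearGroup.det g)) + b)
    (X : (AutomorphyDatum.gl n K hcpt).arch.lie) {θ : (AdelicGroupData.gl n K).Adelic → ℂ}
    (hθ : θ ∈ Submodule.span ℂ {ψ, (1 : (AdelicGroupData.gl n K).Adelic → ℂ)}) :
    lieDeriv (AutomorphyDatum.gl n K hcpt).ofArch X θ ∈
      Submodule.span ℂ {ψ, (1 : (AdelicGroupData.gl n K).Adelic → ℂ)} := by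
  obtain ⟨lam, hlam⟩ := exists_linearMap_log_ideleNorm_det_ofArch_expMem hcpt
  obtain ⟨c, d, rfl⟩ := Submodule.mem_span_pair.1 hθ
  rw [lieDeriv_affLogDet (affLogDet_smul_add hψ c d) hlam X]
  have : (fun _ : (AdelicGroupData.gl n K).Adelic => c * a * (lam X : ℂ)) =
      (c * a * (lam X : ℂ)) • (1 : (AdelicGroupData.gl n K).Adelic → ℂ) := by
    funext g
    rw [Pi.smul_apply, Pi.one_apply, smul_eq_mul, mul_one]
  rw [this]
  exact Submodule.smul_mem _ _ (Submodule.subset_span (Set.mem_insert_of_mem _ rfl))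

/-- Iterated Lie derivatives of `ψ` stay in `span {ψ, 1}`. [folklore] -/
theorem iterLieDeriv_mem_span_affLogDet
    (hψ : ∀ g, ψ g = a * Real.log (GaloisRepresentations.ideleNorm (Matrix.GeneralLinearGroup.det g)) + b)
    (w : List (AutomorphyDatum.gl n K hcpt).arch.lie) :
    iterLieDeriv (AutomorphyDatum.gl n K hcpt).ofArch w ψ ∈
      Submodule.span ℂ {ψ, (1 : (AdelicGroupData.gl n K).Adelic → ℂ)} := by
  induction w with
  | nil => exact Submodule.subset_span (Set.mem_insert _ _)
  | cons X w ih => exact lieDeriv_mem_span_affLogDet hψ X ih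

/-- The `Z(𝔤)`-orbit span of `ψ` (indeed its whole `U(𝔤)`-orbit span) lies in `span {ψ, 1}`.
Borel–Jacquet 1979, §1.6. [cite: BorelJacquet1979, §1.6] -/
theorem zOrbitSpan_affLogDet_le
    (hψ : ∀ g, ψ g = a * Real.log (GaloisRepresentations.ideleNorm (Matrix.GeneralLinearGroup.det g)) + b) :
    zOrbitSpan (AutomorphyDatum.gl n K hcpt).ofArch ψ ≤
      Submodule.span ℂ {ψ, (1 : (AdelicGroupData.gl n K).Adelic → ℂ)} := by
  refine Submodule.span_le.2 ?_
  rintro _ ⟨p, -, rfl⟩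
  unfold applyFree Finsupp.sum
  exact Submodule.sum_mem _ fun w _ =>
    Submodule.smul_mem _ _ (iterLieDeriv_mem_span_affLogDet hψ _)

/-- `ψ = a log |det|_𝔸 + b` is `Z(𝔤)`-finite. Borel–Jacquet 1979, §4.2 (c). [cite: BorelJacquet1979, §4.2] -/
theorem isZFinite_affLogDet
    (hψ : ∀ g, ψ g = a * Real.log (GaloisRepresentations.ideleNorm (Matrix.GeneralLinearGroup.det g)) + b) :
    IsZFinite (AutomorphyDatum.gl n K hcpt).ofArch ψ := by
  haveI : FiniteDimensional ℂ
      (Submodule.span ℂ ({ψ, 1} : Set ((AdelicGroupData.gl n K).Adelic → ℂ))) :=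
    FiniteDimensional.span_of_finite ℂ (Set.toFinite _)
  exact Submodule.finiteDimensional_of_le (zOrbitSpan_affLogDet_le hψ)

/-- The right `K_∞`-translates of `ψ` lie in `span {ψ, 1}`. Borel–Jacquet 1979, §1.3. [cite: BorelJacquet1979, §1.3] -/
theorem kTranslateSpan_affLogDet_le
    (hψ : ∀ g, ψ g = a * Real.log (GaloisRepresentations.ideleNorm (Matrix.GeneralLinearGroup.det g)) + b) :
    kTranslateSpan (AutomorphyDatum.gl n K hcpt).ofArch ψ ≤
      Submodule.span ℂ {ψ, (1 : (AdelicGroupData.gl n K).Adelic → ℂ)} := by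
  refine Submodule.span_le.2 ?_
  rintro _ ⟨k, rfl⟩
  set x := (AutomorphyDatum.gl n K hcpt).ofArch
    (Subgroup.inclusion (AutomorphyDatum.gl n K hcpt).arch.maximalCompact_le_carrier k) with hx
  have : archTranslate (AutomorphyDatum.gl n K hcpt).ofArch
      (Subgroup.inclusion (AutomorphyDatum.gl n K hcpt).arch.maximalCompact_le_carrier k) ψ =
      ψ + (a * (Real.log (GaloisRepresentations.ideleNorm (Matrix.GeneralLinearGroup.det x)) : ℂ)) •
        (1 : (AdelicGroupData.gl n K).Adelic → ℂ) := by
    funext g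
    rw [archTranslate_apply, Pi.add_apply, Pi.smul_apply, Pi.one_apply, smul_eq_mul, mul_one]
    exact affLogDet_apply_mul hψ g x
  dsimp only
  rw [SetLike.mem_coe, this]
  exact Submodule.add_mem _ (Submodule.subset_span (Set.mem_insert _ _))
    (Submodule.smul_mem _ _ (Submodule.subset_span (Set.mem_insert_of_mem _ rfl)))

/-- `ψ = a log |det|_𝔸 + b` is right `K_∞`-finite. Borel–Jacquet 1979, §4.2 (b). [cite: BorelJacquet1979, §4.2] -/
theorem isKFinite_affLogDet
    (hψ : ∀ g, ψ g = a * Real.log (GaloisRepresentations.ideleNorm (Matrix.GeneralLinearGroup.det g)) + b) :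
    IsKFinite (AutomorphyDatum.gl n K hcpt).ofArch ψ := by
  haveI : FiniteDimensional ℂ
      (Submodule.span ℂ ({ψ, 1} : Set ((AdelicGroupData.gl n K).Adelic → ℂ))) :=
    FiniteDimensional.span_of_finite ℂ (Set.toFinite _)
  exact Submodule.finiteDimensional_of_le (kTranslateSpan_affLogDet_le hψ)

/-- `|log x| ≤ x + x⁻¹` for `x > 0`. [folklore] -/
theorem abs_log_le_add_inv {x : ℝ} (hx : 0 < x) : |Real.log x| ≤ x + x⁻¹ := by
  have hx' : 0 ≤ x⁻¹ := inv_nonneg.2 hx.le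
  rcases le_or_gt 1 x with h1 | h1
  · rw [abs_of_nonneg (Real.log_nonneg h1)]
    linarith [Real.log_le_sub_one_of_pos hx]
  · rw [abs_of_neg (Real.log_neg hx h1), ← Real.log_inv]
    linarith [Real.log_le_sub_one_of_pos (inv_pos.2 hx)]

/-- **Moderate growth of `a log |det|_𝔸 + b`**: `|log |det g|_𝔸| ≤ |det g|_𝔸 + |det g|_𝔸⁻¹ ≤
2 (n!)^{[K:ℚ]} (1 ⊔ ‖g‖)^{n [K:ℚ]}` (`ideleNorm_det_le_height`, `ideleNorm_det_inv_le_height`; `n ≥ 1`).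
Borel–Jacquet 1979, §4.2 (d). [cite: BorelJacquet1979, §4.2] -/
theorem hasModerateGrowth_affLogDet [NeZero n]
    (hψ : ∀ g, ψ g = a * Real.log (GaloisRepresentations.ideleNorm (Matrix.GeneralLinearGroup.det g)) + b) :
    HasModerateGrowth (AutomorphyDatum.gl n K hcpt) ψ := by
  set d := Module.finrank ℚ K with hd
  refine ⟨2 * ‖a‖ * (n.factorial : ℝ) ^ d + ‖b‖, n * d, fun g => ?_⟩
  rw [AutomorphyDatum.gl_height]
  set N : ℝ := GaloisRepresentations.ideleNorm (Matrix.GeneralLinearGroup.det g) with hN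
  set M : ℝ := (n.factorial : ℝ) ^ d * (1 ⊔ adelicHeightGL n K g) ^ (n * d) with hM
  have hN0 : 0 < N := ideleNorm_det_pos g
  have hNM : N ≤ M := ideleNorm_det_le_height g
  have hNM' : N⁻¹ ≤ M := ideleNorm_det_inv_le_height g
  have hH1 : (1 : ℝ) ≤ (1 ⊔ adelicHeightGL n K g) ^ (n * d) := one_le_pow₀ le_sup_left
  have hlog : |Real.log N| ≤ 2 * M := (abs_log_le_add_inv hN0).trans (by linarith)
  rw [hψ g]
  calc ‖a * (Real.log N : ℂ) + b‖ ≤ ‖a * (Real.log N : ℂ)‖ + ‖b‖ := norm_add_le _ _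
    _ = ‖a‖ * |Real.log N| + ‖b‖ := by rw [norm_mul, Complex.norm_real, Real.norm_eq_abs]
    _ ≤ ‖a‖ * (2 * M) + ‖b‖ * (1 ⊔ adelicHeightGL n K g) ^ (n * d) :=
        add_le_add (mul_le_mul_of_nonneg_left hlog (norm_nonneg a))
          (le_mul_of_one_le_right (norm_nonneg b) hH1)
    _ = (2 * ‖a‖ * (n.factorial : ℝ) ^ d + ‖b‖) * (1 ⊔ adelicHeightGL n K g) ^ (n * d) := by
        rw [hM]; ring

/-- **`ψ = a log |det|_𝔸 + b` is an automorphic form on `GL_n(𝔸_K)`** (`n ≥ 1`) in the sense of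
Borel–Jacquet 1979, §4.2: conditions (a)–(d) are `isLeftInvariant_affLogDet`,
`isRightInvariantUnder_affLogDet`, `isArchSmooth_affLogDet`, `isKFinite_affLogDet`,
`isZFinite_affLogDet`, `hasModerateGrowth_affLogDet`. (Borel–Jacquet impose no condition at the split
component `A_G`; compare Mœglin–Waldspurger 1994, I.2.17, where the functions
`P(H_G(g)) e^{⟨λ, H_G(g)⟩} φ(g)`, `P` a polynomial on `𝔞_G`, are the general automorphic forms.)
[cite: BorelJacquet1979, §4.2] -/
theorem isAutomorphicForm_affLogDet [NeZero n]
    (hψ : ∀ g, ψ g = a * Real.log (GaloisRepresentations.ideleNorm (Matrix.GeneralLinearGroup.det g)) + b) :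
    IsAutomorphicForm (AutomorphyDatum.gl n K hcpt) ψ where
  leftInvariant := isLeftInvariant_affLogDet hψ
  exists_level := by
    obtain ⟨U, hU⟩ := finiteLevelsGL_nonempty n K hcpt
    exact ⟨U, hU, isRightInvariantUnder_affLogDet hψ hU⟩
  archSmooth := isArchSmooth_affLogDet hψ
  kFinite := isKFinite_affLogDet hψ
  zFinite := isZFinite_affLogDet hψ
  moderateGrowth := hasModerateGrowth_affLogDet hψ

end Affine

/-! ### The stable spaces `span {log |det|_𝔸, 1}` and `span {1}`

In the docstrings below `𝓛` stands for the function `g ↦ log |det g|_𝔸` on `GL_n(𝔸_K)` (written out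
in full in the statements: this proofs file introduces no definition and no notation). -/

section Spaces

variable (hcpt : isCompact_glFiniteIntegralLevel n K)

/-- `𝓛 = 1 · log |det|_𝔸 + 0`. [folklore] -/
theorem logDet_eq_aff : ∀ g : (AdelicGroupData.gl n K).Adelic,
    (fun g : (AdelicGroupData.gl n K).Adelic =>
        ((Real.log (GaloisRepresentations.ideleNorm (Matrix.GeneralLinearGroup.det g)) : ℝ) : ℂ)) g = 1 * Real.log (GaloisRepresentations.ideleNorm (Matrix.GeneralLinearGroup.det g)) + 0 :=
  fun g => by simp only [one_mul, add_zero]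

/-- `1 = 0 · log |det|_𝔸 + 1`. [folklore] -/
theorem one_eq_aff : ∀ g : (AdelicGroupData.gl n K).Adelic,
    (1 : (AdelicGroupData.gl n K).Adelic → ℂ) g =
      0 * Real.log (GaloisRepresentations.ideleNorm (Matrix.GeneralLinearGroup.det g)) + 1 :=
  fun g => by simp only [Pi.one_apply, zero_mul, zero_add]

/-- **`r(h) (c 𝓛 + d) = (c 𝓛 + d) + c log |det h|_𝔸 · 1`**: right translation acts on
`span {𝓛, 1}` unipotently. [folklore] -/
theorem rightTranslation_smul_logDet_add (c d : ℂ) (h : (AdelicGroupData.gl n K).Adelic) :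
    rightTranslation (AdelicGroupData.gl n K) h (c • (fun g : (AdelicGroupData.gl n K).Adelic =>
        ((Real.log (GaloisRepresentations.ideleNorm (Matrix.GeneralLinearGroup.det g)) : ℝ) : ℂ)) + d • (1 : (AdelicGroupData.gl n K).Adelic → ℂ)) =
      (c • (fun g : (AdelicGroupData.gl n K).Adelic =>
        ((Real.log (GaloisRepresentations.ideleNorm (Matrix.GeneralLinearGroup.det g)) : ℝ) : ℂ)) + d • (1 : (AdelicGroupData.gl n K).Adelic → ℂ)) +
        (c * (Real.log (GaloisRepresentations.ideleNorm (Matrix.GeneralLinearGroup.det h)) : ℂ)) •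
          (1 : (AdelicGroupData.gl n K).Adelic → ℂ) := by
  funext g
  rw [rightTranslation_apply, affLogDet_apply_mul (affLogDet_smul_add logDet_eq_aff c d) g h]
  simp only [Pi.add_apply, Pi.smul_apply, Pi.one_apply, smul_eq_mul, mul_one]

/-- `span {𝓛, 1}` is stable under right translation by every `h ∈ GL_n(𝔸_K)`. [folklore] -/
theorem span_logDet_le_comap_rightTranslation (h : (AdelicGroupData.gl n K).Adelic) :
    Submodule.span ℂ {(fun g : (AdelicGroupData.gl n K).Adelic =>
        ((Real.log (GaloisRepresentations.ideleNorm (Matrix.GeneralLinearGroup.det g)) : ℝ) : ℂ)), (1 : (AdelicGroupData.gl n K).Adelic → ℂ)} ≤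
      (Submodule.span ℂ {(fun g : (AdelicGroupData.gl n K).Adelic =>
        ((Real.log (GaloisRepresentations.ideleNorm (Matrix.GeneralLinearGroup.det g)) : ℝ) : ℂ)), (1 : (AdelicGroupData.gl n K).Adelic → ℂ)}).comap
        (rightTranslation (AdelicGroupData.gl n K) h) := by
  intro θ hθ
  obtain ⟨c, d, rfl⟩ := Submodule.mem_span_pair.1 hθ
  rw [Submodule.mem_comap, rightTranslation_smul_logDet_add]
  exact Submodule.add_mem _ hθ
    (Submodule.smul_mem _ _ (Submodule.subset_span (Set.mem_insert_of_mem _ rfl)))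

/-- `span {1}` (the constants) is fixed by right translation. [folklore] -/
theorem span_one_le_comap_rightTranslation (h : (AdelicGroupData.gl n K).Adelic) :
    Submodule.span ℂ {(1 : (AdelicGroupData.gl n K).Adelic → ℂ)} ≤
      (Submodule.span ℂ {(1 : (AdelicGroupData.gl n K).Adelic → ℂ)}).comap
        (rightTranslation (AdelicGroupData.gl n K) h) := by
  intro θ hθ
  obtain ⟨c, rfl⟩ := Submodule.mem_span_singleton.1 hθ
  have h1 : rightTranslation (AdelicGroupData.gl n K) h (1 : (AdelicGroupData.gl n K).Adelic → ℂ) = 1 := by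
    funext g; rfl
  rw [Submodule.mem_comap, map_smul, h1]
  exact hθ

/-- The Lie derivatives kill the constants. [folklore] -/
theorem lieDeriv_one_gl (X : (AutomorphyDatum.gl n K hcpt).arch.lie) :
    lieDeriv (AutomorphyDatum.gl n K hcpt).ofArch X (1 : (AdelicGroupData.gl n K).Adelic → ℂ) = 0 := by
  funext g
  simp only [lieDeriv, Pi.one_apply, deriv_const, Pi.zero_apply]

/-- **`span {log |det|_𝔸, 1}` is a `(𝔤, K_∞) × GL_n(𝔸_K^∞)`-stable space of automorphic forms**
(`n ≥ 1`). Borel–Jacquet 1979, §4.2–4.3. [cite: BorelJacquet1979, §4.3] -/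
theorem isStableSubmodule_span_logDet [NeZero n] :
    IsStableSubmodule (AutomorphyDatum.gl n K hcpt)
      (Submodule.span ℂ {(fun g : (AdelicGroupData.gl n K).Adelic =>
        ((Real.log (GaloisRepresentations.ideleNorm (Matrix.GeneralLinearGroup.det g)) : ℝ) : ℂ)), (1 : (AdelicGroupData.gl n K).Adelic → ℂ)}) where
  le_automorphicForms := Submodule.span_le.2 (by
    rintro θ (rfl | rfl)
    · exact (isAutomorphicForm_affLogDet (hcpt := hcpt) logDet_eq_aff).mem_automorphicForms
    · exact (isAutomorphicForm_affLogDet (hcpt := hcpt) one_eq_aff).mem_automorphicForms)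
  finite_stable h _ := span_logDet_le_comap_rightTranslation h
  k_stable k := span_logDet_le_comap_rightTranslation _
  lie_stable X θ hθ := lieDeriv_mem_span_affLogDet logDet_eq_aff X hθ

/-- `span {1}` is a stable space of automorphic forms (`n ≥ 1`). Borel–Jacquet 1979, §4.2–4.3. [cite: BorelJacquet1979, §4.3] -/
theorem isStableSubmodule_span_one [NeZero n] :
    IsStableSubmodule (AutomorphyDatum.gl n K hcpt)
      (Submodule.span ℂ {(1 : (AdelicGroupData.gl n K).Adelic → ℂ)}) where
  le_automorphicForms := Submodule.span_le.2 (by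
    rintro θ rfl
    exact (isAutomorphicForm_affLogDet (hcpt := hcpt) one_eq_aff).mem_automorphicForms)
  finite_stable h _ := span_one_le_comap_rightTranslation h
  k_stable k := span_one_le_comap_rightTranslation _
  lie_stable X θ hθ := by
    obtain ⟨c, rfl⟩ := Submodule.mem_span_singleton.1 hθ
    rw [lieDeriv_smul, lieDeriv_one_gl, smul_zero]
    exact Submodule.zero_mem _

/-- `span {1} < span {𝓛, 1}`: `log |det|_𝔸` is not constant (`n ≥ 1`; `log |det 1|_𝔸 = 0 ≠ log |det t_{v,1}|_𝔸`). [folklore] -/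
theorem span_one_lt_span_logDet [NeZero n] :
    Submodule.span ℂ {(1 : (AdelicGroupData.gl n K).Adelic → ℂ)} <
      Submodule.span ℂ {(fun g : (AdelicGroupData.gl n K).Adelic =>
        ((Real.log (GaloisRepresentations.ideleNorm (Matrix.GeneralLinearGroup.det g)) : ℝ) : ℂ)), (1 : (AdelicGroupData.gl n K).Adelic → ℂ)} := by
  refine lt_of_le_of_ne (Submodule.span_mono (Set.subset_insert _ _)) fun heq => ?_
  have hL : (fun g : (AdelicGroupData.gl n K).Adelic =>
        ((Real.log (GaloisRepresentations.ideleNorm (Matrix.GeneralLinearGroup.det g)) : ℝ) : ℂ)) ∈ Submodule.span ℂ {(1 : (AdelicGroupData.gl n K).Adelic → ℂ)} := by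
    rw [heq]; exact Submodule.subset_span (Set.mem_insert _ _)
  obtain ⟨c, hc⟩ := Submodule.mem_span_singleton.1 hL
  obtain ⟨h₀, -, hh₀⟩ :=
    exists_finiteAdelic_log_ideleNorm_det_ne_zero (isCompact_glFiniteIntegralLevel_holds n K)
  have h1 := congr_fun hc 1
  have h2 := congr_fun hc h₀
  simp only [Pi.smul_apply, Pi.one_apply, smul_eq_mul, mul_one] at h1 h2
  rw [log_ideleNorm_det_one, Complex.ofReal_zero] at h1
  rw [h1, eq_comm, Complex.ofReal_eq_zero] at h2
  exact hh₀ h2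

/-- **`span {𝓛, 1} / span {1}` is irreducible**: there is no subspace strictly between (the quotient
is a line). [folklore] -/
theorem eq_or_eq_of_span_one_le_of_le_span_logDet
    (W'' : Submodule ℂ ((AdelicGroupData.gl n K).Adelic → ℂ))
    (h₁ : Submodule.span ℂ {(1 : (AdelicGroupData.gl n K).Adelic → ℂ)} ≤ W'')
    (h₂ : W'' ≤ Submodule.span ℂ {(fun g : (AdelicGroupData.gl n K).Adelic =>
        ((Real.log (GaloisRepresentations.ideleNorm (Matrix.GeneralLinearGroup.det g)) : ℝ) : ℂ)), (1 : (AdelicGroupData.gl n K).Adelic → ℂ)}) :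
    W'' = Submodule.span ℂ {(1 : (AdelicGroupData.gl n K).Adelic → ℂ)} ∨
      W'' = Submodule.span ℂ {(fun g : (AdelicGroupData.gl n K).Adelic =>
        ((Real.log (GaloisRepresentations.ideleNorm (Matrix.GeneralLinearGroup.det g)) : ℝ) : ℂ)), (1 : (AdelicGroupData.gl n K).Adelic → ℂ)} := by
  by_cases hle : W'' ≤ Submodule.span ℂ {(1 : (AdelicGroupData.gl n K).Adelic → ℂ)}
  · exact Or.inl (le_antisymm hle h₁)
  · right
    obtain ⟨θ, hθW, hθ1⟩ := SetLike.not_le_iff_exists.1 hle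
    obtain ⟨c, d, rfl⟩ := Submodule.mem_span_pair.1 (h₂ hθW)
    have hc : c ≠ 0 := by
      rintro rfl
      apply hθ1
      rw [zero_smul, zero_add]
      exact Submodule.smul_mem _ _ (Submodule.subset_span rfl)
    refine le_antisymm h₂ (Submodule.span_le.2 ?_)
    rintro η (rfl | rfl)
    · have key : (fun g : (AdelicGroupData.gl n K).Adelic =>
        ((Real.log (GaloisRepresentations.ideleNorm (Matrix.GeneralLinearGroup.det g)) : ℝ) : ℂ)) = c⁻¹ • ((c • (fun g : (AdelicGroupData.gl n K).Adelic =>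
        ((Real.log (GaloisRepresentations.ideleNorm (Matrix.GeneralLinearGroup.det g)) : ℝ) : ℂ)) + d • (1 : (AdelicGroupData.gl n K).Adelic → ℂ)) -
          d • (1 : (AdelicGroupData.gl n K).Adelic → ℂ)) := by
        rw [add_sub_cancel_right, smul_smul, inv_mul_cancel₀ hc, one_smul]
      rw [SetLike.mem_coe, key]
      exact Submodule.smul_mem _ _ (Submodule.sub_mem _ hθW
        (h₁ (Submodule.smul_mem _ _ (Submodule.subset_span rfl))))
    · exact h₁ (Submodule.subset_span rfl)

end Spaces

/-! ### `GL_1`: the cuspidal datum `span {log ‖·‖_𝔸, 1} / ℂ · 1` has no stable complement -/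

section GLOne

variable (hcpt : isCompact_glFiniteIntegralLevel 1 K)

/-- On `GL_1` every automorphic form is a cusp form (there is no proper parabolic subgroup: the cusp
condition `CuspConditionGL 1 K φ k`, `0 < k < 1`, is empty), so `span {log ‖·‖_𝔸, 1} ≤ 𝒜₀(GL_1)`.
Borel–Jacquet 1979, 4.4. [cite: BorelJacquet1979, 4.4] -/
theorem span_logDet_le_cuspFormsGL_one :
    Submodule.span ℂ {(fun g : (AdelicGroupData.gl 1 K).Adelic =>
        ((Real.log (GaloisRepresentations.ideleNorm (Matrix.GeneralLinearGroup.det g)) : ℝ) : ℂ)), (1 : (AdelicGroupData.gl 1 K).Adelic → ℂ)} ≤ cuspFormsGL 1 K hcpt := by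
  refine Submodule.span_le.2 ?_
  rintro θ (rfl | rfl)
  · exact IsCuspFormGL.mem_cuspFormsGL
      ⟨isAutomorphicForm_affLogDet (hcpt := hcpt) logDet_eq_aff, fun k hk hk1 => absurd hk1 (by omega)⟩
  · exact IsCuspFormGL.mem_cuspFormsGL
      ⟨isAutomorphicForm_affLogDet (hcpt := hcpt) one_eq_aff, fun k hk hk1 => absurd hk1 (by omega)⟩

/-- **A cuspidal automorphic representation datum of `GL_1(𝔸_K)` which is a non-split extension**:
`π_log = W / W'` with `W = span {log ‖·‖_𝔸, 1}`, `W' = ℂ · 1` is a `CuspidalAutomorphicRepData 1 K hcpt`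
(Borel–Jacquet 1979, 4.2 and 4.6, impose no condition at the split component `A_G`; `W / W'` is the
trivial character). [cite: BorelJacquet1979, 4.6] -/
theorem exists_cuspidalAutomorphicRepData_gl_one_span_logDet :
    ∃ π : CuspidalAutomorphicRepData 1 K hcpt,
      π.1.W = Submodule.span ℂ {(fun g : (AdelicGroupData.gl 1 K).Adelic =>
        ((Real.log (GaloisRepresentations.ideleNorm (Matrix.GeneralLinearGroup.det g)) : ℝ) : ℂ)), (1 : (AdelicGroupData.gl 1 K).Adelic → ℂ)} ∧
        π.1.W' = Submodule.span ℂ {(1 : (AdelicGroupData.gl 1 K).Adelic → ℂ)} :=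
  ⟨⟨{ W := Submodule.span ℂ {(fun g : (AdelicGroupData.gl 1 K).Adelic =>
        ((Real.log (GaloisRepresentations.ideleNorm (Matrix.GeneralLinearGroup.det g)) : ℝ) : ℂ)), (1 : (AdelicGroupData.gl 1 K).Adelic → ℂ)}
      W' := Submodule.span ℂ {(1 : (AdelicGroupData.gl 1 K).Adelic → ℂ)}
      lt := span_one_lt_span_logDet
      stable := isStableSubmodule_span_logDet hcpt
      stable' := isStableSubmodule_span_one hcpt
      irreducible := fun W'' h₁ h₂ _ => eq_or_eq_of_span_one_le_of_le_span_logDet W'' h₁ h₂ },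
    span_logDet_le_cuspFormsGL_one hcpt⟩, rfl, rfl⟩

/-- **`π_log` has no cuspidal realisation on a stable complement of `W'`.** If `π₀ = W₀ / ⊥` were a
cuspidal datum with `W₀ ⊓ ℂ·1 = ⊥` and `W₀ ⊔ ℂ·1 = span {log ‖·‖_𝔸, 1}`, pick `ψ = c log ‖·‖_𝔸 + d ∈ W₀`,
`ψ ≠ 0`; then `c ≠ 0`, and for the finite idele `t_v` (`‖t_v‖_𝔸 = q_v⁻¹`) stability of `W₀` under
`GL_1(𝔸_K^∞)` gives `r(t_v) ψ - ψ = c log q_v⁻¹ · 1 ∈ W₀ ⊓ ℂ·1 = ⊥`, i.e. `c log q_v⁻¹ = 0`, absurd.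
[folklore] -/
theorem not_exists_cuspidal_complement_span_logDet (π : CuspidalAutomorphicRepData 1 K hcpt)
    (hW : π.1.W = Submodule.span ℂ {(fun g : (AdelicGroupData.gl 1 K).Adelic =>
        ((Real.log (GaloisRepresentations.ideleNorm (Matrix.GeneralLinearGroup.det g)) : ℝ) : ℂ)), (1 : (AdelicGroupData.gl 1 K).Adelic → ℂ)})
    (hW' : π.1.W' = Submodule.span ℂ {(1 : (AdelicGroupData.gl 1 K).Adelic → ℂ)}) :
    ¬ ∃ π₀ : CuspidalAutomorphicRepData 1 K hcpt,
      π₀.1.W' = ⊥ ∧ π₀.1.W ⊓ π.1.W' = ⊥ ∧ π₀.1.W ⊔ π.1.W' = π.1.W := by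
  rintro ⟨π₀, h0, hinf, hsup⟩
  rw [hW'] at hinf hsup
  rw [hW] at hsup
  -- a non-zero `ψ = c 𝓛₁ + d ∈ W₀`
  have hne : π₀.1.W ≠ ⊥ := by
    intro h
    have hlt := π₀.1.lt
    rw [h0, h] at hlt
    exact lt_irrefl _ hlt
  obtain ⟨ψ, hψW, hψ0⟩ := (Submodule.ne_bot_iff _).1 hne
  have hψmem : ψ ∈ Submodule.span ℂ {(fun g : (AdelicGroupData.gl 1 K).Adelic =>
        ((Real.log (GaloisRepresentations.ideleNorm (Matrix.GeneralLinearGroup.det g)) : ℝ) : ℂ)), (1 : (AdelicGroupData.gl 1 K).Adelic → ℂ)} :=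
    hsup ▸ Submodule.mem_sup_left hψW
  obtain ⟨c, d, rfl⟩ := Submodule.mem_span_pair.1 hψmem
  -- `c ≠ 0` since `W₀ ⊓ ℂ·1 = ⊥`
  have hc : c ≠ 0 := by
    rintro rfl
    apply hψ0
    have hmem : (0 : ℂ) • (fun g : (AdelicGroupData.gl 1 K).Adelic =>
        ((Real.log (GaloisRepresentations.ideleNorm (Matrix.GeneralLinearGroup.det g)) : ℝ) : ℂ)) + d • (1 : (AdelicGroupData.gl 1 K).Adelic → ℂ) ∈
        π₀.1.W ⊓ Submodule.span ℂ {(1 : (AdelicGroupData.gl 1 K).Adelic → ℂ)} :=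
      Submodule.mem_inf.2
        ⟨hψW, by rw [zero_smul, zero_add]; exact Submodule.smul_mem _ _ (Submodule.subset_span rfl)⟩
    rw [hinf] at hmem
    exact (Submodule.mem_bot ℂ).1 hmem
  -- a finite idele moving `log ‖·‖_𝔸`, and stability of `W₀`
  obtain ⟨h, hh, hlog⟩ := exists_finiteAdelic_log_ideleNorm_det_ne_zero hcpt
  have hstab := π₀.1.stable.finite_stable h hh hψW
  rw [Submodule.mem_comap, rightTranslation_smul_logDet_add] at hstab
  have hmem : (c * (Real.log (GaloisRepresentations.ideleNorm (Matrix.GeneralLinearGroup.det h)) : ℂ)) •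
      (1 : (AdelicGroupData.gl 1 K).Adelic → ℂ) ∈
        π₀.1.W ⊓ Submodule.span ℂ {(1 : (AdelicGroupData.gl 1 K).Adelic → ℂ)} := by
    refine Submodule.mem_inf.2 ⟨?_, Submodule.smul_mem _ _ (Submodule.subset_span rfl)⟩
    have hsub := Submodule.sub_mem _ hstab hψW
    rwa [add_sub_cancel_left] at hsub
  rw [hinf, Submodule.mem_bot] at hmem
  have h1 := congr_fun hmem 1
  simp only [Pi.smul_apply, Pi.one_apply, smul_eq_mul, mul_one, Pi.zero_apply, mul_eq_zero,
    Complex.ofReal_eq_zero] at h1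
  exact h1.elim hc hlog

/-- **The named fact `cuspidal_W'_eq_bot` of `AutomorphicRepsGL` fails for `GL_1`** (every number
field `K`, every compactness witness `hcpt`): the cuspidal datum `span {log ‖·‖_𝔸, 1} / ℂ · 1`
(`exists_cuspidalAutomorphicRepData_gl_one_span_logDet`) is not realised on a stable complement
(`not_exists_cuspidal_complement_span_logDet`). What is true (Gelfand–Piatetski-Shapiro;
Borel–Jacquet 1979, 4.6 *with* a central character, Mœglin–Waldspurger 1994, I.2.18) is the
semisimplicity of the space of cusp forms on which `A_G` acts by a character; without that proviso
`log ‖det‖_𝔸 · V₀` produces non-split self-extensions of every clean cuspidal datum `V₀` (the same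
computation for `n ≥ 2`, given a cusp form). [folklore] -/
theorem not_cuspidal_W'_eq_bot_gl_one : ¬ cuspidal_W'_eq_bot hcpt := by
  obtain ⟨π, hW, hW'⟩ := exists_cuspidalAutomorphicRepData_gl_one_span_logDet hcpt
  exact fun h => not_exists_cuspidal_complement_span_logDet hcpt π hW hW' (h π)

/-- The unconditional form: for every number field `K`, `cuspidal_W'_eq_bot` fails on `GL_1(𝔸_K)`
with the proved compactness witness `isCompact_glFiniteIntegralLevel_holds 1 K`. [folklore] -/
theorem not_cuspidal_W'_eq_bot_gl_one' (K : Type) [Field K] [NumberField K] :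
    ¬ cuspidal_W'_eq_bot (isCompact_glFiniteIntegralLevel_holds 1 K) :=
  not_cuspidal_W'_eq_bot_gl_one _

end GLOne

/-- **The family `∀ n K hcpt, cuspidal_W'_eq_bot hcpt` is `False`** (instantiate at `GL_1 / ℚ`): every
theorem taking it as a hypothesis — `ArthurClozel_fibres_quadratic_of_leaves`,
`JacquetShalika_eq_of_rsData_eq_of_leaves` — holds vacuously. [folklore] -/
theorem not_forall_cuspidal_W'_eq_bot :
    ¬ ∀ {n : ℕ} {K : Type} [Field K] [NumberField K] (hK : isCompact_glFiniteIntegralLevel n K),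
      cuspidal_W'_eq_bot hK :=
  fun h => not_cuspidal_W'_eq_bot_gl_one' ℚ (h _)

end Literature.NumberTheory.Automorphic
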